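import Mathlib
import HarnessLib
import Literature.Geometry.DiscreteGeometry.LayerPropagation

/-!
# The covering angle of the FCC/HCP shells: every direction is within `45°` of a neighbour

Route `BrittleRungDescent`, support item `SoftLayerPropagation` (stmt-AtomisticToContinuum-9210),
helper file (η = 0, vocabulary of `FejesTothKissingTwelve.lean` / `LayerShells.lean`: shells on
`S²(2)`, frame `u₁, u₂, w, 𝗁e₃`).

* `exists_mem_hexagonSet_inner_ge` — for a horizontal `d`, some hexagon vector `η` has
  `⟪η, d⟫ ≥ √3 ‖d‖` (every planar direction is within `30°` of one of the six);
* `exists_mem_holeTriple_inner_ge` — for a horizontal `d`, some hole point `t ∈ holeTriple σ` has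
  `⟪t, d⟫ ≥ ‖d‖/√3` (three vectors of norm `2/√3` at `120°`);
* `exists_mem_layerShell_inner_ge` — **every direction is within `45°` of a point of a layer shell**:
  for every `d`, some `p ∈ layerShell σ σ′` has `⟪p, d⟫ ≥ √2 ‖d‖` (hexagon for flat directions, the
  triple on the side of `d` for steep ones; equality in the direction of a square-face centre);
* `exists_mem_inner_ge_of_isArrangedIn` — the same for every FCC- or HCP-arranged set (a frame puts
  its hexagon on the standard hexagon, `IsTwelveConfig.eq_layerShell`);
* `exists_mem_kissingShell_norm_add_sub_sq_le` — hence **a centre with a pattern shell has a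
  neighbour closer to any far point**: some `p` in the shell of `y` has
  `‖y + p − c‖² ≤ ‖y − c‖² − 2√2 ‖y − c‖ + 4` (`< ‖y − c‖²` as soon as `‖y − c‖ > √2`).

All statements are elementary ([folklore]).
-/

noncomputable section

namespace Summit.AtomisticToContinuum.Crystallization.Theorems

open Literature.Geometry.DiscreteGeometry Literature.MathematicalPhysics.StatisticalMechanics
open RealInnerProductSpace

/-! ### The hexagon covers the horizontal directions within `30°` -/

/-- Among `2x`, `x + √3 y`, `x − √3 y` one has absolute value `≥ √3 · √(x² + y²)`. [folklore] -/
theorem exists_abs_ge_sqrt_three_mul (x y : ℝ) :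
    3 * (x ^ 2 + y ^ 2) ≤ (2 * x) ^ 2 ∨ 3 * (x ^ 2 + y ^ 2) ≤ (x + Real.sqrt 3 * y) ^ 2 ∨
      3 * (x ^ 2 + y ^ 2) ≤ (x - Real.sqrt 3 * y) ^ 2 := by
  have h3 : Real.sqrt 3 ^ 2 = 3 := sqrt_three_sq
  by_contra h
  push Not at h
  obtain ⟨h1, h2, h3'⟩ := h
  have hx : x ^ 2 < 3 * y ^ 2 := by nlinarith
  have ha : 2 * Real.sqrt 3 * (x * y) < 2 * x ^ 2 := by nlinarith
  have hb : -(2 * Real.sqrt 3 * (x * y)) < 2 * x ^ 2 := by nlinarith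
  have hc : 3 * (x * y) ^ 2 < x ^ 4 := by
    have hab : |Real.sqrt 3 * (x * y)| < x ^ 2 := abs_lt.2 ⟨by linarith, by linarith⟩
    have h0 : 0 ≤ |Real.sqrt 3 * (x * y)| := abs_nonneg _
    have := mul_self_lt_mul_self h0 hab
    rw [← sq, sq_abs, mul_pow, h3] at this
    nlinarith
  have hx0 : 0 < x ^ 2 := by
    by_contra h0
    have : x ^ 2 = 0 := le_antisymm (not_lt.1 h0) (sq_nonneg x)
    rw [show x ^ 4 = (x ^ 2) ^ 2 by ring, this] at hc
    nlinarith [sq_nonneg (x * y)]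
  nlinarith

/-- **The hexagon covers the horizontal directions**: for a horizontal `d` some `η ∈ hexagonSet`
has `⟪η, d⟫ ≥ √3 ‖d‖`. [folklore] -/
theorem exists_mem_hexagonSet_inner_ge {d : EuclideanSpace ℝ (Fin 3)} (hd : d 2 = 0) :
    ∃ η ∈ hexagonSet, Real.sqrt 3 * ‖d‖ ≤ ⟪η, d⟫ := by
  have h3 : Real.sqrt 3 ^ 2 = 3 := sqrt_three_sq
  have hs3 : 0 < Real.sqrt 3 := by positivity
  have hn : ‖d‖ ^ 2 = d 0 ^ 2 + d 1 ^ 2 := by rw [norm_sq_fin3, hd]; ring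
  have hn0 : 0 ≤ ‖d‖ := norm_nonneg d
  -- a candidate with `|⟪η, d⟫| ≥ √3 ‖d‖`; then `η` or `−η` works
  have key : ∀ η : EuclideanSpace ℝ (Fin 3), η ∈ hexagonSet → -η ∈ hexagonSet →
      3 * (d 0 ^ 2 + d 1 ^ 2) ≤ ⟪η, d⟫ ^ 2 → ∃ η ∈ hexagonSet, Real.sqrt 3 * ‖d‖ ≤ ⟪η, d⟫ := by
    intro η hη hη' hsq
    have hsq' : (Real.sqrt 3 * ‖d‖) ^ 2 ≤ |⟪η, d⟫| ^ 2 := by rw [mul_pow, h3, hn, sq_abs]; exact hsq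
    have habs : Real.sqrt 3 * ‖d‖ ≤ |⟪η, d⟫| := (abs_le_of_sq_le_sq' hsq' (abs_nonneg _)).2
    rcases le_or_gt 0 ⟪η, d⟫ with h0 | h0
    · exact ⟨η, hη, by rwa [abs_of_nonneg h0] at habs⟩
    · exact ⟨-η, hη', by rw [inner_neg_left]; rwa [abs_of_neg h0] at habs⟩
  rcases exists_abs_ge_sqrt_three_mul (d 0) (d 1) with h | h | h
  · refine key (triangularVec₁ 2) (by simp [hexagonSet]) (by simp [hexagonSet]) ?_
    rw [inner_fin3]; simpa using h
  · refine key (triangularVec₂ 2) (by simp [hexagonSet]) (by simp [hexagonSet]) ?_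
    rw [inner_fin3]; simp [hd]; nlinarith [h]
  · refine key (triangularVec₁ 2 - triangularVec₂ 2) (by simp [hexagonSet])
      (by rw [neg_sub]; simp [hexagonSet]) ?_
    rw [inner_fin3]; simp [hd]; nlinarith [h]

/-! ### A hole triple covers the horizontal directions within `60°` -/

/-- Of three reals summing to `0` whose squares sum to `2q`, the largest is `≥ √(q/3)`:
`q ≤ 3 M²` for `M = max`. [folklore] -/
theorem le_three_mul_sq_max {x y z q : ℝ} (hsum : x + y + z = 0) (hsq : x ^ 2 + y ^ 2 + z ^ 2 = 2 * q) :
    ∃ M : ℝ, (M = x ∨ M = y ∨ M = z) ∧ 0 ≤ M ∧ q ≤ 3 * M ^ 2 := by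
  -- the largest of the three
  rcases le_total y x with hyx | hxy
  · rcases le_total z x with hzx | hxz
    · refine ⟨x, Or.inl rfl, by nlinarith, ?_⟩
      nlinarith [mul_nonneg (sub_nonneg.2 hyx) (sub_nonneg.2 hzx)]
    · refine ⟨z, Or.inr (Or.inr rfl), by nlinarith, ?_⟩
      nlinarith [mul_nonneg (sub_nonneg.2 hxz) (sub_nonneg.2 (hyx.trans hxz))]
  · rcases le_total z y with hzy | hyz
    · refine ⟨y, Or.inr (Or.inl rfl), by nlinarith, ?_⟩
      nlinarith [mul_nonneg (sub_nonneg.2 hxy) (sub_nonneg.2 hzy)]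
    · refine ⟨z, Or.inr (Or.inr rfl), by nlinarith, ?_⟩
      nlinarith [mul_nonneg (sub_nonneg.2 (hxy.trans hyz)) (sub_nonneg.2 hyz)]

/-- **A hole triple covers the horizontal directions**: for a horizontal `d` and `σ = ±1` some
`t ∈ holeTriple σ` has `⟪t, d⟫ ≥ 0` and `‖d‖² ≤ 3 ⟪t, d⟫²` (i.e. `⟪t, d⟫ ≥ ‖d‖/√3`). [folklore] -/
theorem exists_mem_holeTriple_inner_ge {d : EuclideanSpace ℝ (Fin 3)} (hd : d 2 = 0) {σ : ℝ}
    (hσ : σ = 1 ∨ σ = -1) : ∃ t ∈ holeTriple σ, 0 ≤ ⟪t, d⟫ ∧ ‖d‖ ^ 2 ≤ 3 * ⟪t, d⟫ ^ 2 := by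
  have h3 : Real.sqrt 3 ^ 2 = 3 := sqrt_three_sq
  have hn : ‖d‖ ^ 2 = d 0 ^ 2 + d 1 ^ 2 := by rw [norm_sq_fin3, hd]; ring
  set x := ⟪σ • (barlowOffset 2 : EuclideanSpace ℝ (Fin 3)), d⟫ with hx
  set y := ⟪σ • (barlowOffset 2 - triangularVec₁ 2 : EuclideanSpace ℝ (Fin 3)), d⟫ with hy
  set z := ⟪σ • (barlowOffset 2 - triangularVec₂ 2 : EuclideanSpace ℝ (Fin 3)), d⟫ with hz
  have hσ2 : σ ^ 2 = 1 := by rcases hσ with rfl | rfl <;> norm_num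
  have ex : x = σ * (d 0 + Real.sqrt 3 / 3 * d 1) := by
    rw [hx, real_inner_smul_left, inner_fin3]
    simp only [frameW_apply_zero, frameW_apply_one, frameW_apply_two, hd, mul_zero, add_zero, one_mul]
  have ey : y = σ * (-d 0 + Real.sqrt 3 / 3 * d 1) := by
    rw [hy, real_inner_smul_left, inner_fin3]
    simp only [PiLp.sub_apply, frameW_apply_zero, frameW_apply_one, frameW_apply_two, frameU_apply_zero,
      frameU_apply_one, frameU_apply_two, hd, mul_zero, add_zero]
    ring
  have ez : z = σ * (-(2 * Real.sqrt 3 / 3) * d 1) := by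
    rw [hz, real_inner_smul_left, inner_fin3]
    simp only [PiLp.sub_apply, frameW_apply_zero, frameW_apply_one, frameW_apply_two, frameV_apply_zero,
      frameV_apply_one, frameV_apply_two, hd, mul_zero, add_zero]
    ring
  have hsum : x + y + z = 0 := by rw [ex, ey, ez]; ring
  have hsq : x ^ 2 + y ^ 2 + z ^ 2 = 2 * ‖d‖ ^ 2 := by
    rw [ex, ey, ez, hn]; linear_combination (2 / 3 * d 1 ^ 2 * σ ^ 2) * h3 + (2 * (d 0 ^ 2 + d 1 ^ 2)) * hσ2
  obtain ⟨M, hM, hM0, hle⟩ := le_three_mul_sq_max hsum hsq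
  rcases hM with rfl | rfl | rfl
  · exact ⟨_, by simp [holeTriple], hM0, hle⟩
  · exact ⟨_, by simp [holeTriple], hM0, hle⟩
  · exact ⟨_, by simp [holeTriple], hM0, hle⟩

/-! ### A layer shell covers all directions within `45°` -/

/-- **Every direction is within `45°` of a point of a layer shell**: for every `d` some
`p ∈ layerShell σ σ′` (`σ, σ′ = ±1`) has `⟪p, d⟫ ≥ √2 ‖d‖`. [folklore] -/
theorem exists_mem_layerShell_inner_ge {σ σ' : ℝ} (hσ : σ = 1 ∨ σ = -1) (hσ' : σ' = 1 ∨ σ' = -1)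
    (d : EuclideanSpace ℝ (Fin 3)) : ∃ p ∈ layerShell σ σ', Real.sqrt 2 * ‖d‖ ≤ ⟪p, d⟫ := by
  have h2 : Real.sqrt 2 ^ 2 = 2 := Real.sq_sqrt (by norm_num)
  have h3 : Real.sqrt 3 ^ 2 = 3 := sqrt_three_sq
  have hs2 : 0 < Real.sqrt 2 := by positivity
  have hs3 : 0 < Real.sqrt 3 := by positivity
  have hh := layerSpacing_pos
  have hh2 := layerSpacing_sq
  -- horizontal part `dh` and height `b = d 2`
  set dh : EuclideanSpace ℝ (Fin 3) := d - (d 2 / layerSpacing) • layerNormal layerSpacing with hdh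
  have hdh2 : dh 2 = 0 := by simp [hdh, hh.ne']
  have hsplit : d = dh + (d 2 / layerSpacing) • layerNormal layerSpacing := by rw [hdh]; abel
  have hnd : ‖d‖ ^ 2 = ‖dh‖ ^ 2 + d 2 ^ 2 := by
    rw [norm_sq_fin3, norm_sq_fin3, hdh2]
    simp [hdh]
  have ha0 : 0 ≤ ‖dh‖ := norm_nonneg _
  have hd0 : 0 ≤ ‖d‖ := norm_nonneg _
  -- inner products with horizontal vectors and with lifted hole points
  have hor : ∀ q : EuclideanSpace ℝ (Fin 3), q 2 = 0 → ⟪q, d⟫ = ⟪q, dh⟫ := by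
    intro q hq
    rw [hsplit, inner_add_right, real_inner_smul_right]
    have : ⟪q, layerNormal layerSpacing⟫ = 0 := by rw [inner_fin3]; simp [hq]
    rw [this, mul_zero, add_zero]
  have lift : ∀ q : EuclideanSpace ℝ (Fin 3), q 2 = 0 → ∀ s : ℝ,
      ⟪q + s • layerNormal layerSpacing, d⟫ = ⟪q, dh⟫ + s * layerSpacing * d 2 := by
    intro q hq s
    rw [inner_add_left, hor q hq, real_inner_smul_left]
    have : ⟪layerNormal layerSpacing, d⟫ = layerSpacing * d 2 := by rw [inner_fin3]; simp
    rw [this]; ring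
  by_cases hflat : 2 * ‖d‖ ^ 2 ≤ 3 * ‖dh‖ ^ 2
  · -- flat direction: the hexagon
    obtain ⟨η, hη, hle⟩ := exists_mem_hexagonSet_inner_ge hdh2
    refine ⟨η, hexagonSet_subset_layerShell _ _ hη, ?_⟩
    rw [hor η (apply_two_of_mem_hexagonSet hη)]
    have h1 : (Real.sqrt 2 * ‖d‖) ^ 2 ≤ (Real.sqrt 3 * ‖dh‖) ^ 2 := by
      rw [mul_pow, mul_pow, h2, h3]; exact hflat
    have h1' := (abs_le_of_sq_le_sq' h1 (mul_nonneg hs3.le ha0)).2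
    linarith
  · -- steep direction: the hole triple on the side of `d`
    push Not at hflat
    have hside : ∀ {τ s : ℝ}, (τ = 1 ∨ τ = -1) → (s = 1 ∨ s = -1) → 0 ≤ s * d 2 →
        (∀ t ∈ holeTriple τ, t + s • layerNormal layerSpacing ∈ layerShell σ σ') →
        ∃ p ∈ layerShell σ σ', Real.sqrt 2 * ‖d‖ ≤ ⟪p, d⟫ := by
      intro τ s hτ hs hsd hmem
      obtain ⟨t, ht, ht0, htle⟩ := exists_mem_holeTriple_inner_ge hdh2 hτ
      refine ⟨t + s • layerNormal layerSpacing, hmem t ht, ?_⟩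
      rw [lift t (apply_two_of_mem_holeTriple ht) s]
      -- `a = ‖dh‖`, `b = |d 2| = s * d 2`, `m = ⟪t, dh⟫ ≥ a/√3`; want `√2 ‖d‖ ≤ m + 𝗁 b`
      have hs2' : s ^ 2 = 1 := by rcases hs with rfl | rfl <;> norm_num
      have hb2 : (s * d 2) ^ 2 = d 2 ^ 2 := by rw [mul_pow, hs2', one_mul]
      set a := ‖dh‖ with ha
      set b := s * d 2 with hb
      set m := ⟪t, dh⟫ with hm
      have hab : a ^ 2 < 2 * b ^ 2 := by rw [hb2]; nlinarith [hnd]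
      have hb0 : 0 ≤ b := hsd
      have hma : a ≤ Real.sqrt 3 * m := by
        have : a ^ 2 ≤ (Real.sqrt 3 * m) ^ 2 := by rw [mul_pow, h3]; exact htle
        exact (abs_le_of_sq_le_sq' this (mul_nonneg hs3.le ht0)).2
      -- the key inequality `(a/√3 + 𝗁 b)² ≥ 2 (a² + b²)` on `0 ≤ a ≤ √2 b`
      have hkey : 2 * (a ^ 2 + b ^ 2) ≤ (m + layerSpacing * b) ^ 2 := by
        have hab' : a ≤ Real.sqrt 2 * b := by
          have : a ^ 2 ≤ (Real.sqrt 2 * b) ^ 2 := by rw [mul_pow, h2]; exact hab.le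
          exact (abs_le_of_sq_le_sq' this (mul_nonneg hs2.le hb0)).2
        -- with `m ≥ a/√3`: `(m + 𝗁 b)² ≥ (a/√3 + 𝗁 b)²`, and
        -- `(a/√3 + 𝗁b)² − 2(a²+b²) = a²/3 + (2𝗁/√3) a b + 𝗁² b² − 2a² − 2b²`, `𝗁² = 8/3`, `𝗁/√3 = 2√2/3`
        have hhs : layerSpacing * Real.sqrt 3 = 2 * Real.sqrt 2 := by
          have : (layerSpacing * Real.sqrt 3) ^ 2 = (2 * Real.sqrt 2) ^ 2 := by
            rw [mul_pow, mul_pow, hh2, h3, h2]; norm_num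
          exact le_antisymm (abs_le_of_sq_le_sq' this.le (mul_nonneg zero_le_two hs2.le)).2
            (abs_le_of_sq_le_sq' this.ge (mul_nonneg hh.le hs3.le)).2
        have hlow : 2 * (a ^ 2 + b ^ 2) * 3 ≤ (a + Real.sqrt 3 * layerSpacing * b) ^ 2 := by
          have e : (a + Real.sqrt 3 * layerSpacing * b) ^ 2 =
              a ^ 2 + 2 * (layerSpacing * Real.sqrt 3) * (a * b) + 3 * layerSpacing ^ 2 * b ^ 2 := by
            linear_combination (layerSpacing ^ 2 * b ^ 2) * h3
          rw [e, hhs, hh2]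
          -- `3(2a² + 2b²) ≤ a² + 4√2 ab + 8 b²` iff `0 ≤ (5a + √2 b)(√2 b − a)`
          nlinarith [mul_nonneg (by nlinarith : 0 ≤ 5 * a + Real.sqrt 2 * b) (sub_nonneg.2 hab'), h2]
        have hmono : (a + Real.sqrt 3 * layerSpacing * b) ^ 2 ≤ (Real.sqrt 3 * (m + layerSpacing * b)) ^ 2 := by
          have h0 : 0 ≤ a + Real.sqrt 3 * layerSpacing * b := by positivity
          have h1 : a + Real.sqrt 3 * layerSpacing * b ≤ Real.sqrt 3 * (m + layerSpacing * b) := by nlinarith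
          exact pow_le_pow_left₀ h0 h1 2
        rw [mul_pow, h3] at hmono
        nlinarith
      have hfin : (Real.sqrt 2 * ‖d‖) ^ 2 ≤ (m + layerSpacing * b) ^ 2 := by
        rw [mul_pow, h2, hnd, ← hb2]; exact hkey
      have hpos : 0 ≤ m + layerSpacing * b := by positivity
      calc Real.sqrt 2 * ‖d‖ ≤ m + layerSpacing * b := (abs_le_of_sq_le_sq' hfin hpos).2
        _ = m + s * layerSpacing * d 2 := by rw [hb]; ring
    rcases le_or_gt 0 (d 2) with hz | hz
    · exact hside hσ (Or.inl rfl) (by simpa using hz) fun t ht =>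
        mem_layerShell_iff.2 (Or.inr (Or.inl (by simpa using ht)))
    · exact hside hσ' (Or.inr rfl) (by nlinarith) fun t ht =>
        mem_layerShell_iff.2 (Or.inr (Or.inr (by simpa [sub_eq_add_neg] using ht)))

/-! ### The same for every FCC- or HCP-arranged set, and the closer neighbour -/

/-- A set arranged in the FCC or HCP pattern is a kissing configuration. [folklore] -/
theorem isKissingConfig_of_isArrangedIn {T : Set (EuclideanSpace ℝ (Fin 3))}
    (hT : IsArrangedIn T fccKissingPattern ∨ IsArrangedIn T hcpKissingPattern) : IsKissingConfig T := by
  rcases hT with ⟨A, rfl⟩ | ⟨A, rfl⟩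
  · have := isKissingConfig_fcc.image_linearIsometry A
    convert this using 1
    ext x; simp
  · have := isKissingConfig_hcp.image_linearIsometry A
    convert this using 1
    ext x; simp

/-- **Every direction is within `45°` of a point of an FCC/HCP-arranged set**: for every `d`
some `p ∈ T` has `⟪p, d⟫ ≥ √2 ‖d‖`. [folklore] -/
theorem exists_mem_inner_ge_of_isArrangedIn {T : Set (EuclideanSpace ℝ (Fin 3))}
    (hT : IsArrangedIn T fccKissingPattern ∨ IsArrangedIn T hcpKissingPattern)
    (d : EuclideanSpace ℝ (Fin 3)) : ∃ p ∈ T, Real.sqrt 2 * ‖d‖ ≤ ⟪p, d⟫ := by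
  -- a frame putting a hexagon of `T` on the standard hexagon
  obtain ⟨L, hL⟩ : ∃ L : EuclideanSpace ℝ (Fin 3) ≃ₗᵢ[ℝ] EuclideanSpace ℝ (Fin 3), hexagonSet ⊆ L ⁻¹' T := by
    rcases hT with h | h
    · exact exists_frame_of_isArrangedIn_fcc h
    · obtain ⟨L, hL, -⟩ := exists_frame_of_isArrangedIn_hcp h
      exact ⟨L, hL⟩
  have hK : IsKissingConfig (L ⁻¹' T) := by
    have := (isKissingConfig_of_isArrangedIn hT).image_linearIsometry L.symm.toLinearIsometry
    convert this using 1
    ext x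
    simp only [Set.mem_preimage, Set.mem_image, LinearIsometryEquiv.coe_toLinearIsometry]
    constructor
    · intro hx; exact ⟨L x, hx, L.symm_apply_apply x⟩
    · rintro ⟨y, hy, rfl⟩; simpa using hy
  obtain ⟨σ, σ', hσ, hσ', hS⟩ := hK.isTwelveConfig.eq_layerShell hL
  obtain ⟨p, hp, hle⟩ := exists_mem_layerShell_inner_ge hσ hσ' (L.symm d)
  refine ⟨L p, ?_, ?_⟩
  · have : p ∈ L ⁻¹' T := by rw [hS]; exact hp
    exact this
  · have e : ⟪L p, d⟫ = ⟪p, L.symm d⟫ := by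
      conv_lhs => rw [← L.apply_symm_apply d]
      rw [L.inner_map_map]
    rw [e, ← L.symm.norm_map d]; exact hle

/-- **A centre with a pattern shell has a neighbour closer to any far point**: if the shell of the
centre `y` of `V` is FCC- or HCP-arranged then for every point `c` some `p` in the shell satisfies
`‖(y + p) − c‖² ≤ ‖y − c‖² − 2√2 ‖y − c‖ + 4` (and `y + p ∈ V` is a touching centre).
[folklore] -/
theorem exists_mem_kissingShell_norm_add_sub_sq_le {V : Set (EuclideanSpace ℝ (Fin 3))}
    {y : EuclideanSpace ℝ (Fin 3)}
    (hy : IsArrangedIn (kissingShell V y) fccKissingPattern ∨ IsArrangedIn (kissingShell V y) hcpKissingPattern)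
    (c : EuclideanSpace ℝ (Fin 3)) :
    ∃ p ∈ kissingShell V y, ‖y + p - c‖ ^ 2 ≤ ‖y - c‖ ^ 2 - 2 * Real.sqrt 2 * ‖y - c‖ + 4 := by
  obtain ⟨p, hp, hle⟩ := exists_mem_inner_ge_of_isArrangedIn hy (c - y)
  refine ⟨p, hp, ?_⟩
  have hp2 : ‖p‖ = 2 := hp.2
  have e : y + p - c = p - (c - y) := by abel
  rw [norm_sub_rev c y] at hle
  rw [e, norm_sub_sq_real, hp2, norm_sub_rev c y]
  nlinarith [hle]

end Summit.AtomisticToContinuum.Crystallization.Theorems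

end
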